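import Literature.MathematicalPhysics.QuantumFieldTheory.ConformalBootstrap3D.PointKernelK34v2Data
import Literature.MathematicalPhysics.QuantumFieldTheory.ConformalBootstrap3D.PointKernelParts

/-!
# K34v2 certificate, kernel part file P30: one-cell head segments 145, 146 in level ranges

The head cells whose kernel evaluation exceeds one `decide` are one-cell segments of `hsegsK34v2`; each is
checked by `PCert.hPartSideOK` (side conditions) and `PCert.hPartOK` per level range `[n_lo, n_lo + count)`
against an integer claim, the claims summing to `≥ 0` (`PointKernel.partsOK`); soundness is
`PCert.hParts_sound` (`PointKernelParts`).  The part files `P1, P2, …` are mutually independent (each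
imports only the data file); the ranges of one cell may span several of them, and the per-cell
conclusions `hparts_i` / `hcell_i` of those cells are assembled in `PointKernelK34v2.lean`.
Estimated kernel time 241 s.
-/

set_option maxRecDepth 100000
set_option maxHeartbeats 0

namespace Literature.MathematicalPhysics.QuantumFieldTheory.ConformalBootstrap3D.PointKernelK34v2

open Literature.MathematicalPhysics.QuantumFieldTheory.ConformalBootstrap3D.PointKernel

/-- levels `[60, 64)` of segment 145: partial lower sum `≥` claim. [folklore] -/
theorem part_145_6 : certK34v2.hPartOK (PCert.segAt hsegsK34v2 145) JHK34v2 60 4 (419303733340023255761629966224093982) = true := by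
  decide +kernel

/-- levels `[64, 68)` of segment 145: partial lower sum `≥` claim. [folklore] -/
theorem part_145_7 : certK34v2.hPartOK (PCert.segAt hsegsK34v2 145) JHK34v2 64 4 (267488764022884604408475948888169902) = true := by
  decide +kernel

/-- levels `[68, 71)` of segment 145: partial lower sum `≥` claim. [folklore] -/
theorem part_145_8 : certK34v2.hPartOK (PCert.segAt hsegsK34v2 145) JHK34v2 68 3 (134489837664100955314552757714112253) = true := by
  decide +kernel

/-- levels `[71, 73)` of segment 145: partial lower sum `≥` claim. [folklore] -/
theorem part_145_9 : certK34v2.hPartOK (PCert.segAt hsegsK34v2 145) JHK34v2 71 2 (67099422305102617100841519320876002) = true := by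
  decide +kernel

/-- one-cell segment 146 (row 6, cell `[3585/512, 14341/2048]`, chord, `n_F = 72`,
10 level ranges): side conditions. [folklore] -/
theorem pside_146 : certK34v2.hPartSideOK (PCert.segAt hsegsK34v2 146) JHK34v2 = true := by
  decide +kernel

/-- its level ranges `(n_lo, count, claim)`. [folklore] -/
def parts_146 : List (ℕ × ℕ × ℤ) := [(0, 25, -43026507164441664996786503845945712524), (25, 11, 27383206477357262810675483779494071086), (36, 8, 9151885939027814889093012077094743534), (44, 6, 3301128329247840616806450856071729367), (50, 5, 1500462783631141697974663829086398304), (55, 5, 857136007276751364668652164422182436), (60, 4, 405443501128720116567895574769081832), (64, 4, 253580110247216608653323516231933033), (68, 3, 120538191319692114465236480218706739), (71, 2, 53125825205224777881785568556866201)]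

/-- the ranges tile `[0, n_F]` and the claims sum to `≥ 0`. [folklore] -/
theorem pcov_146 : PointKernel.partsOK 72 parts_146 = true := by
  decide +kernel

end Literature.MathematicalPhysics.QuantumFieldTheory.ConformalBootstrap3D.PointKernelK34v2
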